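/-
Copyright: public-audit package `pub-balaban` (b2b-balaban), seat pv28-g12. Released under Apache 2.0 like Mathlib.
-/
import Literature.MathematicalPhysics.QuantumFieldTheory.Balaban1983to89.T4CubeChartGnomonic
import Literature.Analysis.Calculus.SmoothCutoff

/-!
# T4 — caveat (EXT) of `T4CubeChartTransport` discharged for cube windows, WITHOUT loss of modulus:
# a `C²` function `λ`-convex on a neighbourhood cube of `[-S,S]ⁿ` has a GLOBAL `C²` representative with
# `HessianBound _ λ` agreeing with it near `[-S,S]ⁿ`

* Value = kernel certificate closing the bookkeeping gap (EXT) of the Brascamp–Lieb transport `T4CubeChartTransport`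
  (caveat (EXT) there: "`HessianBound` and `ContDiff ℝ 2` are GLOBAL on `ℝⁿ` … The extension lemma (a `λ`-convex `C²`
  function on a neighbourhood of `K` has such a representative, possibly with a smaller `λ`) is NOT typed here"; §3 there:
  "for every `λ' < λ` … loses an arbitrarily small amount of convexity", repaired downstream by the closure step
  `mem_respDom_of_forall_lt_modulus`): for the CUBE windows of the cell the extension lemma IS typed here and NOTHING is
  lost — the same `λ`, no `λ' ↑ λ` limit.  NOT summit progress; NOT continuum; NOT Clay.  0 [cite], 0 [model]: everything
  here is [folklore] (multivariable calculus); NO printed sentence is asserted and nothing internally minted is cited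
  (ABSOLUTE RULE).  The general-compact-set statements in print (`C^{1,1}` / `C^{1,ω}` convex extension of jets — pointer
  arXiv:1501.05226 = Azagra–Mudarra, as already pointed to in `T4CubeChartTransport` §3; the tree's
  `Literature.Analysis.Convex.C11Extension` and `Literature.Analysis.Convex.AlexandrovSemiconvex.convexExtension` — sup of
  affine minorants, merely convex/Lipschitz) are NEITHER used NOR re-proved: the cube admits the elementary COORDINATEWISE
  construction below, which keeps `C²` AND `λ`.

## The construction (§3)

Radii `r₀ < r₁ < r₂` (`0 ≤ r₂`).  With the tree's plateau cutoff `Literature.Analysis.Calculus.cutoff` rescaled to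
`p = cubePlateau r₁ r₂` (`= 1` on `|t| ≤ r₁`, `= 0` on `|t| ≥ r₂`, values in `[0,1]`), the SATURATION `σ(t) = ∫₀ᵗ p`
(`cubeSat`: `σ(t) = t` for `|t| ≤ r₁`, `|σ| ≤ r₂`, `σ' = p`, `C^∞`) and the COLLAR `η(t) = ∫₀ᵗ∫₀ᵘ (1 − cubePlateau r₀ r₁)`
(`cubeCollar`: `η = 0` on `|t| ≤ r₀`, `η'' = 1 − cubePlateau r₀ r₁ ∈ [0,1]`, `= 1` for `|t| ≥ r₁`), put

  `convexExt f r₀ r₁ r₂ B (x) = f(σ(x₁),…,σ(xₙ)) + B · Σᵢ η(xᵢ)`.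

Then `convexExt = f` on the cube `[-r₀,r₀]ⁿ` (`convexExt_eq`), it is `C²` (`contDiff_convexExt`), and along any `w`
(`fderiv_fderiv_convexExt`)

  `D²(convexExt)(x)(w,w) = D²f(σx)(p∘x·w, p∘x·w) + Df(σx)(p'∘x·w·w) + B Σᵢ (1 − cubePlateau r₀ r₁ (xᵢ)) wᵢ²`,

with `σx ∈ [-r₂,r₂]ⁿ` where `D²f ≥ λ`.  Coordinate by coordinate, `λ pᵢ² − M₁|pᵢ'| + B(1 − qᵢ) ≥ λ` once
`B ≥ |λ| + M₁ M₂` (`M₁ ≥ sup_{[-r₂,r₂]ⁿ} ‖Df‖`, `M₂ ≥ sup|p'|`): inside `|xᵢ| < r₁` one has `pᵢ = 1`, `pᵢ' = 0`; outside,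
`1 − qᵢ = 1` and `λpᵢ² + |λ| ≥ λ`.  Hence `HessianBound (convexExt f …) λ` (`hessianBound_convexExt`) — the SAME `λ`.

## Content

* §1 `HessianBoundOn f K λ` (the tree's `T4CubePoincare.HessianBound` restricted to `x ∈ K`), `hessianBoundOn_iff_fderiv`,
  `HessianBound.hessianBoundOn`, `hessianBoundOn_univ_iff`, `HessianBoundOn.mono`, `hessianBoundOn_add`.
* §2 the one-dimensional profiles `cubePlateau`, `cubeSat`, `cubeCollar₁`, `cubeCollar` and their calculus.
* §3 `satMap`, `convexExt`, `convexExt_eq`, `contDiff_convexExt`, `fderiv_convexExt_apply`, `fderiv_fderiv_convexExt`,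
  `hessianBound_convexExt`, and the packaged statements **`exists_hessianBound_extension`** (`0 ≤ S < S'`, `f ∈ C²(ℝⁿ)`,
  `HessianBoundOn f [-S',S']ⁿ λ` ⟹ `∃ g ∈ C²`, `HessianBound g λ`, `g = f` on `[-(S+S')/2, (S+S')/2]ⁿ`) and
  `exists_hessianBound_extension'` (agreement of values AND of `fderiv` on `[-S,S]ⁿ`).
* §4 **`mem_respDom_of_cubeChart_local`**: `T4CubeChartTransport.mem_respDom_of_cubeChart` with the two global hypotheses
  `HessianBound fᵢ λ` replaced by `HessianBoundOn fᵢ [-S',S']ⁿ λ` for some `S' > S` — same conclusion, same `λ`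
  (so the `λ' ↑ λ` closure step `mem_respDom_of_forall_lt_modulus` of §3 there is not needed for cube windows).
* §5 the `SU(2)` gnomonic plug with LOCAL action convexity: `gnoKappa S = 4(1−3S²)/(1+3S²)²` (the window Hessian floor of the
  gnomonic log-Jacobian, `T4CubeChartGnomonic.window_mul_le_fderiv_fderiv_gnoJac`; `gnoKappa 0 = 4`, `−½ ≤ gnoKappa S` on
  `0 ≤ S ≤ 1`), `hessianBoundOn_gnoJac`, and **`mem_respDom_of_gnoChart_local`**: `T4CubeChartGnomonic.mem_respDom_of_gnoChart`
  with `HessianBound gᵢ μ`, `μ > ½`, modulus `μ − ½` replaced by `HessianBoundOn gᵢ [-S',S']ⁿ μ` (`S < S' ≤ 1`),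
  `gnoKappa S' + μ > 0`, modulus `gnoKappa S' + μ` (`≥ μ − ½`, and `→ μ + 4` as `S' ↓ 0`: on small windows the positive
  curvature of the Haar density PAYS INTO `λ` instead of costing `½`).

## Caveats

* (CUBE) The lossless construction is specific to sup-norm CUBES (coordinatewise saturation); for a general compact convex
  window only the `ε`-lossy statements of print apply (not typed; not needed by the cell, whose windows are cubes —
  `T4CubeChartTransport` caveat (CHART)).
* (C²) `f` is asked to be `C²` on all of `ℝⁿ` (only its VALUES near the cube matter: any `C²` function agreeing with the
  transported exponent near the window will do); convexity is asked only on `[-S',S']ⁿ`.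
* (γ) Nothing here sizes `λ`, `b_H`, `L` — Bałaban-side inputs (cell record `t4/T4-EST-O3Eiiib-G7.md` §2quinquies (γ)).
* (RANK) §5 is `SU(2)` only (as `T4CubeChartGnomonic`).
-/

noncomputable section

open _root_.MeasureTheory Set Filter
open Function (updateFinset)
open scoped Topology ContDiff Matrix

namespace Literature.MathematicalPhysics.QuantumFieldTheory.Balaban1983to89.T4CubeConvexExtension

open Literature.Analysis.Calculus (cutoff cutoff_eq_one cutoff_eq_zero cutoff_nonneg cutoff_le_one contDiff_cutoff
  exists_bound_deriv_cutoff deriv_cutoff_eq_zero_of_lt)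
open Literature.Probability.Distributions (coordGradient coordHessian isCompact_cube)
open T4CubePoincare T4CubeChartTransport T4CubeChartGnomonic

variable {n : ℕ}

/-! ## §1  Local Hessian bounds -/

/-- **The convexity input on a set**: `λ (w·w) ≤ wᵀ f_xx(x) w` for `x ∈ K` (`T4CubePoincare.HessianBound` is the case
`K = univ`). [folklore] -/
def HessianBoundOn (f : (Fin n → ℝ) → ℝ) (K : Set (Fin n → ℝ)) (lam : ℝ) : Prop :=
  ∀ x ∈ K, ∀ w : Fin n → ℝ, lam * (w ⬝ᵥ w) ≤ w ⬝ᵥ (coordHessian f x *ᵥ w)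

/-- For `f ∈ C²` the local Hessian bound reads `λ|w|² ≤ D²f(x)(w,w)`, `x ∈ K`. [folklore] -/
theorem hessianBoundOn_iff_fderiv {f : (Fin n → ℝ) → ℝ} (hf : ContDiff ℝ 2 f) {K : Set (Fin n → ℝ)} {lam : ℝ} :
    HessianBoundOn f K lam ↔ ∀ x ∈ K, ∀ w : Fin n → ℝ, lam * (w ⬝ᵥ w) ≤ fderiv ℝ (fderiv ℝ f) x w w := by
  unfold HessianBoundOn
  simp only [quadForm_coordHessian hf]

/-- A global Hessian bound is a local one on every set. [folklore] -/
theorem _root_.Literature.MathematicalPhysics.QuantumFieldTheory.Balaban1983to89.T4CubePoincare.HessianBound.hessianBoundOn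
    {f : (Fin n → ℝ) → ℝ} {lam : ℝ} (h : HessianBound f lam) (K : Set (Fin n → ℝ)) : HessianBoundOn f K lam :=
  fun x _ w => h x w

/-- `HessianBoundOn f univ λ ↔ HessianBound f λ`. [folklore] -/
theorem hessianBoundOn_univ_iff {f : (Fin n → ℝ) → ℝ} {lam : ℝ} : HessianBoundOn f Set.univ lam ↔ HessianBound f lam :=
  ⟨fun h x w => h x (Set.mem_univ x) w, fun h x _ w => h x w⟩

/-- Monotonicity in the set. [folklore] -/
theorem HessianBoundOn.mono {f : (Fin n → ℝ) → ℝ} {K K' : Set (Fin n → ℝ)} {lam : ℝ} (h : HessianBoundOn f K lam)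
    (hK : K' ⊆ K) : HessianBoundOn f K' lam :=
  fun x hx w => h x (hK hx) w

/-- **Additivity** on a set: `Hess f ≥ λ` and `Hess g ≥ μ` on `K` give `Hess (f+g) ≥ λ + μ` on `K`
(`T4CubePoincare.fderiv_fderiv_combo`). [folklore] -/
theorem hessianBoundOn_add {f g : (Fin n → ℝ) → ℝ} (hf : ContDiff ℝ 2 f) (hg : ContDiff ℝ 2 g) {K : Set (Fin n → ℝ)}
    {lam mu : ℝ} (hBf : HessianBoundOn f K lam) (hBg : HessianBoundOn g K mu) :
    HessianBoundOn (fun y => f y + g y) K (lam + mu) := by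
  have hfg : (fun y => f y + g y) = fun y => 1 * f y + 1 * g y := funext fun y => by ring
  rw [hfg, hessianBoundOn_iff_fderiv (contDiff_combo hf hg 1 1)]
  intro x hx w
  rw [fderiv_fderiv_combo hf hg, one_mul, one_mul, add_mul]
  exact add_le_add ((hessianBoundOn_iff_fderiv hf).1 hBf x hx w) ((hessianBoundOn_iff_fderiv hg).1 hBg x hx w)

/-- Cubes are monotone in the half-width. [folklore] -/
theorem cube_subset_cube {S S' : ℝ} (h : S ≤ S') : cube n S ⊆ cube n S' :=
  fun _ hx => mem_cube_iff.2 fun i => (mem_cube_iff.1 hx i).trans h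

/-- A bigger cube is a neighbourhood of every point of a smaller one (sup norm). [folklore] -/
theorem cube_mem_nhds {S S₀ : ℝ} (h : S < S₀) {x : Fin n → ℝ} (hx : x ∈ cube n S) : cube n S₀ ∈ 𝓝 x := by
  refine Filter.mem_of_superset (Metric.ball_mem_nhds x (sub_pos.2 h)) fun y hy => ?_
  rw [mem_cube_iff] at hx ⊢
  intro i
  have h1 : |y i - x i| < S₀ - S := by
    have h2 := dist_le_pi_dist y x i
    rw [Real.dist_eq] at h2
    exact h2.trans_lt (Metric.mem_ball.1 hy)
  linarith [abs_sub_abs_le_abs_sub (y i) (x i), hx i]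

/-! ## §2  One-dimensional profiles: rescaled plateau, saturation, collar -/

section OneDim

variable {a b : ℝ}

/-- The rescaled plateau `p_{a,b}(t) = cutoff (b/(b−a)) (t/(b−a))`: for `a < b`, `= 1` on `|t| ≤ a`, `= 0` on `|t| ≥ b`,
values in `[0,1]`, smooth (`Literature.Analysis.Calculus.cutoff` BY NAME). [folklore] -/
def cubePlateau (a b t : ℝ) : ℝ := cutoff (b / (b - a)) (t / (b - a))

/-- The plateau radius of the rescaled cutoff: `b/(b−a) − 1 = a/(b−a)`. [folklore] -/
theorem cubePlateau_ratio (hab : a < b) : b / (b - a) - 1 = a / (b - a) := by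
  have h : b - a ≠ 0 := (sub_pos.2 hab).ne'
  field_simp
  ring

/-- `p_{a,b} = 1` on `|t| ≤ a`. [folklore] -/
theorem cubePlateau_eq_one (hab : a < b) {t : ℝ} (ht : |t| ≤ a) : cubePlateau a b t = 1 := by
  have hc : 0 < b - a := sub_pos.2 hab
  refine cutoff_eq_one ?_
  rw [cubePlateau_ratio hab, abs_div, abs_of_pos hc]
  exact div_le_div_of_nonneg_right ht hc.le

/-- `p_{a,b} = 0` on `|t| ≥ b`. [folklore] -/
theorem cubePlateau_eq_zero (hab : a < b) {t : ℝ} (ht : b ≤ |t|) : cubePlateau a b t = 0 := by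
  have hc : 0 < b - a := sub_pos.2 hab
  refine cutoff_eq_zero ?_
  rw [abs_div, abs_of_pos hc]
  exact div_le_div_of_nonneg_right ht hc.le

/-- `0 ≤ p_{a,b}`. [folklore] -/
theorem cubePlateau_nonneg (a b t : ℝ) : 0 ≤ cubePlateau a b t := cutoff_nonneg _ _

/-- `p_{a,b} ≤ 1`. [folklore] -/
theorem cubePlateau_le_one (a b t : ℝ) : cubePlateau a b t ≤ 1 := cutoff_le_one _ _

/-- `p_{a,b}` is smooth. [folklore] -/
theorem contDiff_cubePlateau (a b : ℝ) {m : ℕ∞} : ContDiff ℝ m (cubePlateau a b) := by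
  unfold cubePlateau
  exact (contDiff_cutoff _).comp (contDiff_id.div_const _)

/-- `p_{a,b}` is continuous. [folklore] -/
theorem continuous_cubePlateau (a b : ℝ) : Continuous (cubePlateau a b) :=
  (contDiff_cubePlateau a b (m := 0)).continuous

/-- `p_{a,b}` is differentiable. [folklore] -/
theorem differentiable_cubePlateau (a b : ℝ) : Differentiable ℝ (cubePlateau a b) :=
  (contDiff_cubePlateau a b (m := 1)).differentiable (by simp)

/-- `p_{a,b}'` is continuous. [folklore] -/
theorem continuous_deriv_cubePlateau (a b : ℝ) : Continuous (deriv (cubePlateau a b)) :=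
  (contDiff_cubePlateau a b (m := 1)).continuous_deriv (by simp)

/-- Chain rule: `p_{a,b}'(t) = (cutoff R)'(t/(b−a)) / (b−a)`, `R = b/(b−a)`. [folklore] -/
theorem hasDerivAt_cubePlateau (a b t : ℝ) :
    HasDerivAt (cubePlateau a b) (deriv (cutoff (b / (b - a))) (t / (b - a)) / (b - a)) t := by
  have h1 : HasDerivAt (fun t : ℝ => t / (b - a)) (1 / (b - a)) t := (hasDerivAt_id t).div_const _
  have h2 : HasDerivAt (cutoff (b / (b - a))) (deriv (cutoff (b / (b - a))) (t / (b - a))) (t / (b - a)) :=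
    (((contDiff_cutoff (b / (b - a)) (n := 1)).differentiable (by simp)) _).hasDerivAt
  have h3 := h2.comp t h1
  refine (h3.congr_deriv ?_)
  ring

/-- **Uniform bound** `|p_{a,b}'| ≤ D/(b−a)` (`D` the tree's `R`-uniform bound for `|(cutoff R)'|`). [folklore] -/
theorem exists_bound_deriv_cubePlateau (hab : a < b) : ∃ D : ℝ, 0 ≤ D ∧ ∀ t, |deriv (cubePlateau a b) t| ≤ D := by
  obtain ⟨D, hD0, hD⟩ := exists_bound_deriv_cutoff
  have hc : 0 < b - a := sub_pos.2 hab
  refine ⟨D / (b - a), div_nonneg hD0 hc.le, fun t => ?_⟩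
  rw [(hasDerivAt_cubePlateau a b t).deriv, abs_div, abs_of_pos hc]
  exact div_le_div_of_nonneg_right (hD _ _) hc.le

/-- `p_{a,b}' = 0` on the open plateau `|t| < a`. [folklore] -/
theorem deriv_cubePlateau_eq_zero_of_lt (hab : a < b) {t : ℝ} (ht : |t| < a) : deriv (cubePlateau a b) t = 0 := by
  have hc : 0 < b - a := sub_pos.2 hab
  rw [(hasDerivAt_cubePlateau a b t).deriv, deriv_cutoff_eq_zero_of_lt, zero_div]
  rw [cubePlateau_ratio hab, abs_div, abs_of_pos hc]
  exact div_lt_div_of_pos_right ht hc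

/-- Points of `[[0, t]]` are no farther from `0` than `t`. [folklore] -/
theorem abs_le_of_mem_uIcc {t u c : ℝ} (hu : u ∈ uIcc (0 : ℝ) t) (ht : |t| ≤ c) : |u| ≤ c := by
  rw [mem_uIcc] at hu
  rcases hu with h | h
  · rw [abs_of_nonneg h.1]
    exact h.2.trans ((le_abs_self t).trans ht)
  · rw [abs_of_nonpos h.2]
    linarith [neg_abs_le t, h.1]

/-- **Saturation** `σ_{a,b}(t) = ∫₀ᵗ p_{a,b}`. [folklore] -/
def cubeSat (a b t : ℝ) : ℝ := ∫ u in (0 : ℝ)..t, cubePlateau a b u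

/-- `σ' = p`. [folklore] -/
theorem hasDerivAt_cubeSat (a b t : ℝ) : HasDerivAt (cubeSat a b) (cubePlateau a b t) t :=
  ((continuous_cubePlateau a b).integral_hasStrictDerivAt 0 t).hasDerivAt

/-- `deriv σ = p`. [folklore] -/
theorem deriv_cubeSat (a b : ℝ) : deriv (cubeSat a b) = cubePlateau a b :=
  funext fun t => (hasDerivAt_cubeSat a b t).deriv

/-- `σ` is differentiable. [folklore] -/
theorem differentiable_cubeSat (a b : ℝ) : Differentiable ℝ (cubeSat a b) :=
  fun t => (hasDerivAt_cubeSat a b t).differentiableAt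

/-- `σ` is smooth. [folklore] -/
theorem contDiff_cubeSat (a b : ℝ) : ContDiff ℝ ∞ (cubeSat a b) := by
  rw [contDiff_infty_iff_deriv, deriv_cubeSat]
  exact ⟨differentiable_cubeSat a b, contDiff_cubePlateau a b⟩

/-- `σ(0) = 0`. [folklore] -/
theorem cubeSat_zero (a b : ℝ) : cubeSat a b 0 = 0 := intervalIntegral.integral_same

/-- `σ(t) = t` on the plateau `|t| ≤ a`. [folklore] -/
theorem cubeSat_eq_self (hab : a < b) {t : ℝ} (ht : |t| ≤ a) : cubeSat a b t = t := by
  have h : EqOn (cubePlateau a b) (fun _ => (1 : ℝ)) (uIcc 0 t) := fun u hu =>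
    cubePlateau_eq_one hab (abs_le_of_mem_uIcc hu ht)
  rw [cubeSat, intervalIntegral.integral_congr h]
  simp

/-- `σ` is monotone (`σ' = p ≥ 0`). [folklore] -/
theorem monotone_cubeSat (a b : ℝ) : Monotone (cubeSat a b) :=
  monotone_of_deriv_nonneg (differentiable_cubeSat a b) fun t => by
    rw [deriv_cubeSat]
    exact cubePlateau_nonneg a b t

/-- `t ↦ t − σ(t)` is monotone (`σ' = p ≤ 1`). [folklore] -/
theorem monotone_id_sub_cubeSat (a b : ℝ) : Monotone fun t => t - cubeSat a b t := by
  have hd : ∀ t, HasDerivAt (fun t => t - cubeSat a b t) (1 - cubePlateau a b t) t := fun t =>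
    (hasDerivAt_id' t).sub (hasDerivAt_cubeSat a b t)
  exact monotone_of_deriv_nonneg (fun t => (hd t).differentiableAt) fun t => by
    rw [(hd t).deriv]
    exact sub_nonneg.2 (cubePlateau_le_one a b t)

/-- `σ ≤ b` (`0 ≤ b`): `σ(b) ≤ b` and `σ` is constant (`σ' = 0`) beyond `b`. [folklore] -/
theorem cubeSat_le (hab : a < b) (hb : 0 ≤ b) (t : ℝ) : cubeSat a b t ≤ b := by
  have hsb : cubeSat a b b ≤ b := by
    have h := monotone_id_sub_cubeSat a b hb
    simp only [cubeSat_zero, sub_zero] at h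
    linarith
  rcases le_or_gt t b with htb | htb
  · exact (monotone_cubeSat a b htb).trans hsb
  · have hanti : AntitoneOn (cubeSat a b) (Ici b) :=
      antitoneOn_of_deriv_nonpos (convex_Ici b) (contDiff_cubeSat a b).continuous.continuousOn
        (differentiable_cubeSat a b).differentiableOn fun x hx => by
          rw [interior_Ici] at hx
          rw [deriv_cubeSat]
          exact (cubePlateau_eq_zero hab ((le_of_lt hx).trans (le_abs_self x))).le
    exact (hanti (mem_Ici.2 le_rfl) (mem_Ici.2 htb.le) htb.le).trans hsb

/-- `−b ≤ σ` (`0 ≤ b`). [folklore] -/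
theorem neg_le_cubeSat (hab : a < b) (hb : 0 ≤ b) (t : ℝ) : -b ≤ cubeSat a b t := by
  have hsb : -b ≤ cubeSat a b (-b) := by
    have h := monotone_id_sub_cubeSat a b (neg_nonpos.2 hb)
    simp only [cubeSat_zero, sub_zero] at h
    linarith
  rcases le_or_gt (-b) t with htb | htb
  · exact hsb.trans (monotone_cubeSat a b htb)
  · have hanti : AntitoneOn (cubeSat a b) (Iic (-b)) :=
      antitoneOn_of_deriv_nonpos (convex_Iic (-b)) (contDiff_cubeSat a b).continuous.continuousOn
        (differentiable_cubeSat a b).differentiableOn fun x hx => by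
          rw [interior_Iic] at hx
          rw [deriv_cubeSat]
          have hx2 : x < -b := hx
          have hx' : b ≤ |x| := by linarith [neg_le_abs x]
          exact (cubePlateau_eq_zero hab hx').le
    exact hsb.trans (hanti (mem_Iic.2 htb.le) (mem_Iic.2 le_rfl) htb.le)

/-- **`|σ_{a,b}| ≤ b`**: the saturation takes values in `[-b, b]`. [folklore] -/
theorem abs_cubeSat_le (hab : a < b) (hb : 0 ≤ b) (t : ℝ) : |cubeSat a b t| ≤ b :=
  abs_le.2 ⟨neg_le_cubeSat hab hb t, cubeSat_le hab hb t⟩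

/-- **Collar, first primitive** `η₁(t) = ∫₀ᵗ (1 − p_{a,b})`. [folklore] -/
def cubeCollar₁ (a b t : ℝ) : ℝ := ∫ u in (0 : ℝ)..t, (1 - cubePlateau a b u)

/-- **Collar** `η(t) = ∫₀ᵗ η₁`: `η'' = 1 − p_{a,b}` (`= 0` on `|t| ≤ a`, `= 1` on `|t| ≥ b`, in `[0,1]`), `η = η' = 0` on
`|t| ≤ a`. [folklore] -/
def cubeCollar (a b t : ℝ) : ℝ := ∫ u in (0 : ℝ)..t, cubeCollar₁ a b u

/-- `1 − p` is continuous. [folklore] -/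
theorem continuous_one_sub_cubePlateau (a b : ℝ) : Continuous fun t => 1 - cubePlateau a b t :=
  continuous_const.sub (continuous_cubePlateau a b)

/-- `η₁' = 1 − p`. [folklore] -/
theorem hasDerivAt_cubeCollar₁ (a b t : ℝ) : HasDerivAt (cubeCollar₁ a b) (1 - cubePlateau a b t) t :=
  ((continuous_one_sub_cubePlateau a b).integral_hasStrictDerivAt 0 t).hasDerivAt

/-- `deriv η₁ = 1 − p`. [folklore] -/
theorem deriv_cubeCollar₁ (a b : ℝ) : deriv (cubeCollar₁ a b) = fun t => 1 - cubePlateau a b t :=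
  funext fun t => (hasDerivAt_cubeCollar₁ a b t).deriv

/-- `η₁` is differentiable. [folklore] -/
theorem differentiable_cubeCollar₁ (a b : ℝ) : Differentiable ℝ (cubeCollar₁ a b) :=
  fun t => (hasDerivAt_cubeCollar₁ a b t).differentiableAt

/-- `η₁` is smooth. [folklore] -/
theorem contDiff_cubeCollar₁ (a b : ℝ) : ContDiff ℝ ∞ (cubeCollar₁ a b) := by
  rw [contDiff_infty_iff_deriv, deriv_cubeCollar₁]
  exact ⟨differentiable_cubeCollar₁ a b, contDiff_const.sub (contDiff_cubePlateau a b)⟩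

/-- `η₁` is continuous. [folklore] -/
theorem continuous_cubeCollar₁ (a b : ℝ) : Continuous (cubeCollar₁ a b) := (contDiff_cubeCollar₁ a b).continuous

/-- `η' = η₁`. [folklore] -/
theorem hasDerivAt_cubeCollar (a b t : ℝ) : HasDerivAt (cubeCollar a b) (cubeCollar₁ a b t) t :=
  ((continuous_cubeCollar₁ a b).integral_hasStrictDerivAt 0 t).hasDerivAt

/-- `deriv η = η₁`. [folklore] -/
theorem deriv_cubeCollar (a b : ℝ) : deriv (cubeCollar a b) = cubeCollar₁ a b :=
  funext fun t => (hasDerivAt_cubeCollar a b t).deriv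

/-- `η` is differentiable. [folklore] -/
theorem differentiable_cubeCollar (a b : ℝ) : Differentiable ℝ (cubeCollar a b) :=
  fun t => (hasDerivAt_cubeCollar a b t).differentiableAt

/-- `η` is smooth. [folklore] -/
theorem contDiff_cubeCollar (a b : ℝ) : ContDiff ℝ ∞ (cubeCollar a b) := by
  rw [contDiff_infty_iff_deriv, deriv_cubeCollar]
  exact ⟨differentiable_cubeCollar a b, contDiff_cubeCollar₁ a b⟩

/-- `η₁ = 0` on `|t| ≤ a`. [folklore] -/
theorem cubeCollar₁_eq_zero (hab : a < b) {t : ℝ} (ht : |t| ≤ a) : cubeCollar₁ a b t = 0 := by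
  have h : EqOn (fun u => 1 - cubePlateau a b u) (fun _ => (0 : ℝ)) (uIcc 0 t) := fun u hu => by
    simp only [cubePlateau_eq_one hab (abs_le_of_mem_uIcc hu ht), sub_self]
  rw [cubeCollar₁, intervalIntegral.integral_congr h]
  simp

/-- `η = 0` on `|t| ≤ a`. [folklore] -/
theorem cubeCollar_eq_zero (hab : a < b) {t : ℝ} (ht : |t| ≤ a) : cubeCollar a b t = 0 := by
  have h : EqOn (cubeCollar₁ a b) (fun _ => (0 : ℝ)) (uIcc 0 t) := fun u hu =>
    cubeCollar₁_eq_zero hab (abs_le_of_mem_uIcc hu ht)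
  rw [cubeCollar, intervalIntegral.integral_congr h]
  simp

end OneDim

/-! ## §3  The coordinatewise extension and its Hessian -/

section Construction

variable {f : (Fin n → ℝ) → ℝ} {r₀ r₁ r₂ B : ℝ}

/-- Coordinatewise saturation `x ↦ (σ(x₁), …, σ(xₙ))`. [folklore] -/
def satMap (a b : ℝ) (x : Fin n → ℝ) : Fin n → ℝ := fun i => cubeSat a b (x i)

/-- **THE EXTENSION** `f(σx) + B Σᵢ η(xᵢ)`. [folklore] -/
def convexExt (f : (Fin n → ℝ) → ℝ) (r₀ r₁ r₂ B : ℝ) (x : Fin n → ℝ) : ℝ :=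
  f (satMap r₁ r₂ x) + B * ∑ i, cubeCollar r₀ r₁ (x i)

/-- `σx ∈ [-r₂,r₂]ⁿ` for every `x`. [folklore] -/
theorem satMap_mem_cube (h12 : r₁ < r₂) (h2 : 0 ≤ r₂) (x : Fin n → ℝ) : satMap r₁ r₂ x ∈ cube n r₂ :=
  mem_cube_iff.2 fun i => abs_cubeSat_le h12 h2 (x i)

/-- `σx = x` on `[-r₁,r₁]ⁿ`. [folklore] -/
theorem satMap_eq_self (h12 : r₁ < r₂) {x : Fin n → ℝ} (hx : x ∈ cube n r₁) : satMap r₁ r₂ x = x :=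
  funext fun i => cubeSat_eq_self h12 (mem_cube_iff.1 hx i)

/-- **AGREEMENT**: `convexExt f = f` on `[-r₀,r₀]ⁿ` (`r₀ < r₁ < r₂`). [folklore] -/
theorem convexExt_eq (h01 : r₀ < r₁) (h12 : r₁ < r₂) {x : Fin n → ℝ} (hx : x ∈ cube n r₀) :
    convexExt f r₀ r₁ r₂ B x = f x := by
  have hx1 : x ∈ cube n r₁ := cube_subset_cube h01.le hx
  rw [convexExt, satMap_eq_self h12 hx1,
    Finset.sum_eq_zero (fun i _ => cubeCollar_eq_zero h01 (mem_cube_iff.1 hx i)), mul_zero, add_zero]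

/-- `satMap` is smooth. [folklore] -/
theorem contDiff_satMap (a b : ℝ) {m : ℕ∞} : ContDiff ℝ m (satMap (n := n) a b) :=
  contDiff_pi.2 fun i => ((contDiff_cubeSat a b).of_le (by exact_mod_cast le_top)).comp (contDiff_apply ℝ ℝ i)

/-- **`convexExt f` is `C²`** for `f ∈ C²`. [folklore] -/
theorem contDiff_convexExt (hf : ContDiff ℝ 2 f) : ContDiff ℝ 2 (convexExt f r₀ r₁ r₂ B) := by
  unfold convexExt
  refine (hf.comp (contDiff_satMap r₁ r₂ (m := 2))).add (contDiff_const.mul (ContDiff.sum fun i _ => ?_))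
  exact (contDiff_infty.1 (contDiff_cubeCollar r₀ r₁) 2).comp (contDiff_apply ℝ ℝ i)

/-- The derivative of `satMap` at `y`: `w ↦ (p(yᵢ) wᵢ)ᵢ`. [folklore] -/
theorem hasFDerivAt_satMap (a b : ℝ) (y : Fin n → ℝ) :
    HasFDerivAt (satMap (n := n) a b)
      (ContinuousLinearMap.pi fun i =>
        cubePlateau a b (y i) • (ContinuousLinearMap.proj i : (Fin n → ℝ) →L[ℝ] ℝ)) y := by
  have hσ : ∀ i, HasFDerivAt (fun x : Fin n → ℝ => cubeSat a b (x i))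
      (cubePlateau a b (y i) • (ContinuousLinearMap.proj i : (Fin n → ℝ) →L[ℝ] ℝ)) y := fun i => by
    have h := (hasDerivAt_cubeSat a b (y i)).comp_hasFDerivAt y (hasFDerivAt_apply (𝕜 := ℝ) i y)
    exact h
  exact hasFDerivAt_pi.2 hσ

/-- The derivative of `satMap` applied: `(Dσ(y) w)ᵢ = p(yᵢ) wᵢ`. [folklore] -/
theorem satMap_fderivCLM_apply (a b : ℝ) (y w : Fin n → ℝ) :
    (ContinuousLinearMap.pi fun i =>
        cubePlateau a b (y i) • (ContinuousLinearMap.proj i : (Fin n → ℝ) →L[ℝ] ℝ)) w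
      = fun i => cubePlateau a b (y i) * w i := by
  funext i
  simp [ContinuousLinearMap.pi_apply]

/-- **The derivative of `convexExt f`** at `y`. [folklore] -/
theorem hasFDerivAt_convexExt (hf : ContDiff ℝ 2 f) (y : Fin n → ℝ) :
    HasFDerivAt (convexExt f r₀ r₁ r₂ B)
      ((fderiv ℝ f (satMap r₁ r₂ y)).comp
          (ContinuousLinearMap.pi fun i =>
            cubePlateau r₁ r₂ (y i) • (ContinuousLinearMap.proj i : (Fin n → ℝ) →L[ℝ] ℝ))
        + B • ∑ i, cubeCollar₁ r₀ r₁ (y i) • (ContinuousLinearMap.proj i : (Fin n → ℝ) →L[ℝ] ℝ)) y := by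
  have h1 : HasFDerivAt (fun x => f (satMap r₁ r₂ x)) ((fderiv ℝ f (satMap r₁ r₂ y)).comp
      (ContinuousLinearMap.pi fun i =>
        cubePlateau r₁ r₂ (y i) • (ContinuousLinearMap.proj i : (Fin n → ℝ) →L[ℝ] ℝ))) y :=
    ((hf.differentiable (by norm_num)) _).hasFDerivAt.comp y (hasFDerivAt_satMap r₁ r₂ y)
  have hη : ∀ i, HasFDerivAt (fun x : Fin n → ℝ => cubeCollar r₀ r₁ (x i))
      (cubeCollar₁ r₀ r₁ (y i) • (ContinuousLinearMap.proj i : (Fin n → ℝ) →L[ℝ] ℝ)) y := fun i => by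
    have h := (hasDerivAt_cubeCollar r₀ r₁ (y i)).comp_hasFDerivAt y (hasFDerivAt_apply (𝕜 := ℝ) i y)
    exact h
  have h2 : HasFDerivAt (fun x : Fin n → ℝ => B * ∑ i, cubeCollar r₀ r₁ (x i))
      (B • ∑ i, cubeCollar₁ r₀ r₁ (y i) • (ContinuousLinearMap.proj i : (Fin n → ℝ) →L[ℝ] ℝ)) y :=
    (HasFDerivAt.fun_sum fun i _ => hη i).const_mul B
  exact h1.add h2

/-- **`D(convexExt f)(y) w = Df(σy)(p∘y · w) + B Σᵢ η₁(yᵢ) wᵢ`.** [folklore] -/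
theorem fderiv_convexExt_apply (hf : ContDiff ℝ 2 f) (y w : Fin n → ℝ) :
    fderiv ℝ (convexExt f r₀ r₁ r₂ B) y w
      = fderiv ℝ f (satMap r₁ r₂ y) (fun i => cubePlateau r₁ r₂ (y i) * w i)
        + B * ∑ i, cubeCollar₁ r₀ r₁ (y i) * w i := by
  rw [(hasFDerivAt_convexExt hf y).fderiv, add_apply, ContinuousLinearMap.comp_apply, satMap_fderivCLM_apply]
  simp

/-- For `g ∈ C²`: `t ↦ Dg(x + t w) w` has derivative `D²g(x)(w,w)` at `t = 0` (the technique of the tree's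
`le_fderiv_fderiv_of_uniformConvex` / `T4CubeChartGnomonic.hasDerivAt_fderiv_gnoJac_line_fderiv₂`). [folklore] -/
theorem hasDerivAt_fderiv_line {g : (Fin n → ℝ) → ℝ} (hg : ContDiff ℝ 2 g) (x w : Fin n → ℝ) :
    HasDerivAt (fun t : ℝ => fderiv ℝ g (x + t • w) w) (fderiv ℝ (fderiv ℝ g) x w w) 0 := by
  have hdiff : Differentiable ℝ (fderiv ℝ g) := differentiable_fderiv_of_contDiff_two hg
  have hl : HasDerivAt (fun t : ℝ => x + t • w) w 0 := by
    simpa using ((hasDerivAt_id (0 : ℝ)).smul_const w).const_add x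
  have hG : HasFDerivAt (fderiv ℝ g) (fderiv ℝ (fderiv ℝ g) x) (x + (0 : ℝ) • w) := by
    rw [zero_smul, add_zero]; exact (hdiff x).hasFDerivAt
  have hG' : HasDerivAt (fun t : ℝ => fderiv ℝ g (x + t • w)) (fderiv ℝ (fderiv ℝ g) x w) 0 :=
    hG.comp_hasDerivAt (0 : ℝ) hl
  simpa using hG'.clm_apply (hasDerivAt_const (0 : ℝ) w)

/-- The explicit derivative of `t ↦ D(convexExt f)(x + t w) w` at `t = 0`. [folklore] -/
theorem hasDerivAt_fderiv_convexExt_line (hf : ContDiff ℝ 2 f) (x w : Fin n → ℝ) :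
    HasDerivAt (fun t : ℝ => fderiv ℝ (convexExt f r₀ r₁ r₂ B) (x + t • w) w)
      (fderiv ℝ (fderiv ℝ f) (satMap r₁ r₂ x) (fun i => cubePlateau r₁ r₂ (x i) * w i)
          (fun i => cubePlateau r₁ r₂ (x i) * w i)
        + fderiv ℝ f (satMap r₁ r₂ x) (fun i => deriv (cubePlateau r₁ r₂) (x i) * w i * w i)
        + B * ∑ i, (1 - cubePlateau r₀ r₁ (x i)) * w i * w i) 0 := by
  have hfun : (fun t : ℝ => fderiv ℝ (convexExt f r₀ r₁ r₂ B) (x + t • w) w) = fun t =>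
      fderiv ℝ f (satMap r₁ r₂ (x + t • w)) (fun i => cubePlateau r₁ r₂ (x i + t * w i) * w i)
        + B * ∑ i, cubeCollar₁ r₀ r₁ (x i + t * w i) * w i := by
    funext t
    rw [fderiv_convexExt_apply hf]
    rfl
  rw [hfun]
  have hlin : ∀ i, ∀ t : ℝ, HasDerivAt (fun t : ℝ => x i + t * w i) (w i) t := fun i t => by
    simpa using ((hasDerivAt_id t).mul_const (w i)).const_add (x i)
  have hκ : HasDerivAt (fun t : ℝ => satMap r₁ r₂ (x + t • w)) (fun i => cubePlateau r₁ r₂ (x i) * w i) 0 := by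
    refine hasDerivAt_pi.2 fun i => ?_
    have h := (hasDerivAt_cubeSat r₁ r₂ (x i + 0 * w i)).comp (0 : ℝ) (hlin i 0)
    simpa [satMap, Function.comp_def] using h
  have hc : HasDerivAt (fun t : ℝ => fderiv ℝ f (satMap r₁ r₂ (x + t • w)))
      (fderiv ℝ (fderiv ℝ f) (satMap r₁ r₂ x) (fun i => cubePlateau r₁ r₂ (x i) * w i)) 0 := by
    have hG : HasFDerivAt (fderiv ℝ f) (fderiv ℝ (fderiv ℝ f) (satMap r₁ r₂ x))
        (satMap r₁ r₂ (x + (0 : ℝ) • w)) := by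
      rw [zero_smul, add_zero]; exact (differentiable_fderiv_of_contDiff_two hf _).hasFDerivAt
    exact hG.comp_hasDerivAt (0 : ℝ) hκ
  have hu : HasDerivAt (fun t : ℝ => fun i => cubePlateau r₁ r₂ (x i + t * w i) * w i)
      (fun i => deriv (cubePlateau r₁ r₂) (x i) * w i * w i) 0 := by
    refine hasDerivAt_pi.2 fun i => ?_
    have h := (((differentiable_cubePlateau r₁ r₂) (x i + 0 * w i)).hasDerivAt.comp (0 : ℝ) (hlin i 0)).mul_const
      (w i)
    simpa using h
  have h2 : HasDerivAt (fun t : ℝ => B * ∑ i, cubeCollar₁ r₀ r₁ (x i + t * w i) * w i)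
      (B * ∑ i, (1 - cubePlateau r₀ r₁ (x i)) * w i * w i) 0 := by
    have h := (HasDerivAt.fun_sum fun i (_ : i ∈ (Finset.univ : Finset (Fin n))) =>
      ((hasDerivAt_cubeCollar₁ r₀ r₁ (x i + 0 * w i)).comp (0 : ℝ) (hlin i 0)).mul_const (w i)).const_mul B
    simpa using h
  refine ((hc.clm_apply hu).add h2).congr_deriv ?_
  simp only [zero_mul, add_zero, zero_smul]

/-- **THE HESSIAN OF THE EXTENSION ALONG `w`**:
`D²(convexExt f)(x)(w,w) = D²f(σx)(v,v) + Df(σx)(z) + B Σᵢ (1 − q(xᵢ)) wᵢ²`,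
`vᵢ = p(xᵢ) wᵢ`, `zᵢ = p'(xᵢ) wᵢ²`, `q = cubePlateau r₀ r₁`. [folklore] -/
theorem fderiv_fderiv_convexExt (hf : ContDiff ℝ 2 f) (x w : Fin n → ℝ) :
    fderiv ℝ (fderiv ℝ (convexExt f r₀ r₁ r₂ B)) x w w
      = fderiv ℝ (fderiv ℝ f) (satMap r₁ r₂ x) (fun i => cubePlateau r₁ r₂ (x i) * w i)
          (fun i => cubePlateau r₁ r₂ (x i) * w i)
        + fderiv ℝ f (satMap r₁ r₂ x) (fun i => deriv (cubePlateau r₁ r₂) (x i) * w i * w i)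
        + B * ∑ i, (1 - cubePlateau r₀ r₁ (x i)) * w i * w i :=
  (hasDerivAt_fderiv_line (contDiff_convexExt hf) x w).unique (hasDerivAt_fderiv_convexExt_line hf x w)

/-- **THE KEY SCALAR INEQUALITY** per coordinate: with `0 ≤ p ≤ 1`, `|p'| ≤ M₂`, `0 ≤ q ≤ 1`, `0 ≤ M₁`,
`|λ| + M₁M₂ ≤ B`, and EITHER (`p = 1`, `p' = 0`) OR `q = 0`:  `λ ≤ λ p² − M₁|p'| + B(1 − q)`. [folklore] -/
theorem key_scalar_ineq {lam p p' q M₁ M₂ B : ℝ} (hp0 : 0 ≤ p) (hp1 : p ≤ 1) (hp' : |p'| ≤ M₂) (hq1 : q ≤ 1)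
    (hM₁ : 0 ≤ M₁) (hB : |lam| + M₁ * M₂ ≤ B) (hcase : (p = 1 ∧ p' = 0) ∨ q = 0) :
    lam ≤ lam * p ^ 2 - M₁ * |p'| + B * (1 - q) := by
  have hM₂ : 0 ≤ M₂ := (abs_nonneg _).trans hp'
  have hB0 : 0 ≤ B := le_trans (by positivity) hB
  rcases hcase with ⟨hp, hp'0⟩ | hq
  · rw [hp, hp'0, abs_zero]
    nlinarith [mul_nonneg hB0 (sub_nonneg.2 hq1)]
  · rw [hq, sub_zero, mul_one]
    have h3 : M₁ * |p'| ≤ M₁ * M₂ := mul_le_mul_of_nonneg_left hp' hM₁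
    have h4 : lam ≤ lam * p ^ 2 + |lam| := by
      rcases le_or_gt 0 lam with hl | hl
      · rw [abs_of_nonneg hl]
        nlinarith [mul_nonneg hl (sq_nonneg p)]
      · rw [abs_of_neg hl]
        have hp2 : p ^ 2 ≤ 1 := by nlinarith
        nlinarith [mul_le_mul_of_nonpos_left hp2 hl.le]
    linarith

/-- **THE HESSIAN BOUND OF THE EXTENSION — the same `λ`.**  `r₀ < r₁ < r₂`, `0 ≤ r₂`, `f ∈ C²` with
`HessianBoundOn f [-r₂,r₂]ⁿ λ`, `‖Df‖ ≤ M₁` on `[-r₂,r₂]ⁿ` (`0 ≤ M₁`), `|p'| ≤ M₂`, `|λ| + M₁M₂ ≤ B` ⟹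
`HessianBound (convexExt f r₀ r₁ r₂ B) λ`. [folklore] -/
theorem hessianBound_convexExt (hf : ContDiff ℝ 2 f) (h01 : r₀ < r₁) (h12 : r₁ < r₂) (h2 : 0 ≤ r₂) {lam : ℝ}
    (hB : HessianBoundOn f (cube n r₂) lam) {M₁ M₂ : ℝ} (hM₁ : 0 ≤ M₁)
    (hM₁b : ∀ y ∈ cube n r₂, ‖fderiv ℝ f y‖ ≤ M₁) (hM₂b : ∀ t, |deriv (cubePlateau r₁ r₂) t| ≤ M₂)
    (hBge : |lam| + M₁ * M₂ ≤ B) : HessianBound (convexExt f r₀ r₁ r₂ B) lam := by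
  rw [hessianBound_iff_fderiv (contDiff_convexExt hf)]
  intro x w
  rw [fderiv_fderiv_convexExt hf x w]
  set σx := satMap r₁ r₂ x with hσx
  set p : Fin n → ℝ := fun i => cubePlateau r₁ r₂ (x i) with hp
  set p' : Fin n → ℝ := fun i => deriv (cubePlateau r₁ r₂) (x i) with hp'
  set q : Fin n → ℝ := fun i => cubePlateau r₀ r₁ (x i) with hq
  set v : Fin n → ℝ := fun i => cubePlateau r₁ r₂ (x i) * w i with hv
  set z : Fin n → ℝ := fun i => deriv (cubePlateau r₁ r₂) (x i) * w i * w i with hz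
  have hσ : σx ∈ cube n r₂ := satMap_mem_cube h12 h2 x
  -- term 1: the convexity of `f` at `σx ∈ [-r₂,r₂]ⁿ`
  have hT1 : lam * (v ⬝ᵥ v) ≤ fderiv ℝ (fderiv ℝ f) σx v v := (hessianBoundOn_iff_fderiv hf).1 hB σx hσ v
  -- term 2: `|Df(σx) z| ≤ M₁ Σ |p'ᵢ| wᵢ²`
  have hzn : ‖z‖ ≤ ∑ i, |p' i| * (w i * w i) := by
    have hnn : ∀ i, 0 ≤ |p' i| * (w i * w i) := fun i => mul_nonneg (abs_nonneg _) (mul_self_nonneg _)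
    refine (pi_norm_le_iff_of_nonneg (Finset.sum_nonneg fun i _ => hnn i)).2 fun i => ?_
    have hzi : ‖z i‖ = |p' i| * (w i * w i) := by
      rw [Real.norm_eq_abs, show z i = p' i * w i * w i from rfl, abs_mul, abs_mul, mul_assoc, abs_mul_abs_self]
    rw [hzi]
    exact Finset.single_le_sum (f := fun i => |p' i| * (w i * w i)) (fun i _ => hnn i) (Finset.mem_univ i)
  have hT2 : -(M₁ * ∑ i, |p' i| * (w i * w i)) ≤ fderiv ℝ f σx z := by
    have h1 : |fderiv ℝ f σx z| ≤ M₁ * ∑ i, |p' i| * (w i * w i) := by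
      rw [← Real.norm_eq_abs]
      exact (ContinuousLinearMap.le_opNorm _ _).trans (mul_le_mul (hM₁b σx hσ) hzn (norm_nonneg _) hM₁)
    exact neg_le_of_abs_le h1
  -- per coordinate
  have key : ∀ i, lam * (w i * w i)
      ≤ lam * (v i * v i) - M₁ * (|p' i| * (w i * w i)) + B * ((1 - q i) * (w i * w i)) := fun i => by
    have hw : 0 ≤ w i * w i := mul_self_nonneg _
    have hvi : v i * v i = p i ^ 2 * (w i * w i) := by
      simp only [hv, hp]; ring
    have hcase : (p i = 1 ∧ p' i = 0) ∨ q i = 0 := by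
      by_cases hxi : |x i| < r₁
      · exact Or.inl ⟨cubePlateau_eq_one h12 hxi.le, deriv_cubePlateau_eq_zero_of_lt h12 hxi⟩
      · exact Or.inr (cubePlateau_eq_zero h01 (not_lt.1 hxi))
    have hsc := key_scalar_ineq (cubePlateau_nonneg r₁ r₂ (x i)) (cubePlateau_le_one r₁ r₂ (x i)) (hM₂b (x i))
      (cubePlateau_le_one r₀ r₁ (x i)) hM₁ hBge hcase
    rw [hvi]
    calc lam * (w i * w i) ≤ (lam * p i ^ 2 - M₁ * |p' i| + B * (1 - q i)) * (w i * w i) :=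
          mul_le_mul_of_nonneg_right hsc hw
      _ = _ := by ring
  have hsum3 : ∑ i, (1 - cubePlateau r₀ r₁ (x i)) * w i * w i = ∑ i, (1 - q i) * (w i * w i) :=
    Finset.sum_congr rfl fun i _ => by simp only [hq]; ring
  calc lam * (w ⬝ᵥ w) = ∑ i, lam * (w i * w i) := by rw [dotProduct, Finset.mul_sum]
    _ ≤ ∑ i, (lam * (v i * v i) - M₁ * (|p' i| * (w i * w i)) + B * ((1 - q i) * (w i * w i))) :=
        Finset.sum_le_sum fun i _ => key i
    _ = lam * (v ⬝ᵥ v) - M₁ * ∑ i, |p' i| * (w i * w i) + B * ∑ i, (1 - q i) * (w i * w i) := by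
        rw [dotProduct, Finset.sum_add_distrib, Finset.sum_sub_distrib, Finset.mul_sum, Finset.mul_sum,
          Finset.mul_sum]
    _ ≤ _ := by rw [hsum3]; linarith

/-- **THE EXTENSION THEOREM (values).**  `0 ≤ S < S'`, `f ∈ C²(ℝⁿ)`, `Hess f ≥ λ` on `[-S',S']ⁿ` ⟹ there is `g ∈ C²(ℝⁿ)`
with `Hess g ≥ λ` EVERYWHERE (the SAME `λ`) and `g = f` on `[-(S+S')/2, (S+S')/2]ⁿ`. [folklore] -/
theorem exists_hessianBound_extension {S S' lam : ℝ} (hS : 0 ≤ S) (hSS' : S < S') {f : (Fin n → ℝ) → ℝ}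
    (hf : ContDiff ℝ 2 f) (hB : HessianBoundOn f (cube n S') lam) :
    ∃ g : (Fin n → ℝ) → ℝ, ContDiff ℝ 2 g ∧ HessianBound g lam ∧ ∀ x ∈ cube n ((S + S') / 2), g x = f x := by
  obtain ⟨C, hC⟩ := (isCompact_cube n S').exists_bound_of_continuousOn
    ((hf.continuous_fderiv (by norm_num)).continuousOn)
  obtain ⟨M₂, -, hM₂⟩ := exists_bound_deriv_cubePlateau (a := (S + 3 * S') / 4) (b := S') (by linarith)
  refine ⟨convexExt f ((S + S') / 2) ((S + 3 * S') / 4) S' (|lam| + max C 0 * M₂), contDiff_convexExt hf, ?_,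
    fun x hx => convexExt_eq (by linarith) (by linarith) hx⟩
  exact hessianBound_convexExt hf (by linarith) (by linarith) (by linarith) hB (le_max_right C 0)
    (fun y hy => (hC y hy).trans (le_max_left C 0)) hM₂ le_rfl

/-- **THE EXTENSION THEOREM (values and gradients on the window).**  As above, with `g = f` and `Dg = Df` on `[-S,S]ⁿ`
(the agreement holds on the neighbourhood `[-(S+S')/2,(S+S')/2]ⁿ` of the window). [folklore] -/
theorem exists_hessianBound_extension' {S S' lam : ℝ} (hS : 0 ≤ S) (hSS' : S < S') {f : (Fin n → ℝ) → ℝ}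
    (hf : ContDiff ℝ 2 f) (hB : HessianBoundOn f (cube n S') lam) :
    ∃ g : (Fin n → ℝ) → ℝ, ContDiff ℝ 2 g ∧ HessianBound g lam ∧ (∀ x ∈ cube n S, g x = f x) ∧
      ∀ x ∈ cube n S, fderiv ℝ g x = fderiv ℝ f x := by
  obtain ⟨g, hg, hgB, hgf⟩ := exists_hessianBound_extension hS hSS' hf hB
  have hlt : S < (S + S') / 2 := by linarith
  refine ⟨g, hg, hgB, fun x hx => hgf x (cube_subset_cube hlt.le hx), fun x hx => ?_⟩
  exact (Filter.eventuallyEq_of_mem (cube_mem_nhds hlt hx) fun y hy => hgf y hy).fderiv_eq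

/-- NON-VACUITY of the hypothesis class: a global bound is a local one (e.g. the tree's
`T4CubeChartGnomonic.hessianBound_gnoJac`). [folklore] -/
example {f : (Fin n → ℝ) → ℝ} {lam S : ℝ} (h : HessianBound f lam) : HessianBoundOn f (cube n S) lam :=
  h.hessianBoundOn _

end Construction

/-! ## §4  The plug with LOCAL convexity: `mem_respDom_of_cubeChart` for exponents convex on a neighbourhood cube -/

section Plug

variable {P : Params} {j : ℕ} {G : Type*} [GaugeGroup G] [MeasurableSpace G] [HaarData G]
variable [DecidableEq (PBond P j)]
variable {s : Finset (PBond P j)} {χ : Density P j G} {u₀ : GaugeField P j G} {S : ℝ}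
  {φ : (Fin n → ℝ) → (s → G)} {jac : (Fin n → ℝ) → ℝ}

open T4CovarianceResponse (respDom)

/-- **THE PLUG WITH LOCAL CONVEXITY (caveat (EXT) discharged, same `λ`).**
`T4CubeChartTransport.mem_respDom_of_cubeChart` with `HessianBound fᵢ λ` (GLOBAL) replaced by
`HessianBoundOn fᵢ [-S',S']ⁿ λ` for some `S' > S`: the `C²` representatives `f₀, f₁` of `jac − h(u₀←φ·)`,
`jac − h(u←φ·)` on the window need only be `λ`-convex on a slightly larger cube.  Conclusion unchanged:
`u ∈ respDom s χ h u₀ B T dev (b_H/√λ) (L/√λ)`. [folklore] -/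
theorem mem_respDom_of_cubeChart_local {β : Type*} (hc : CubeChart s χ u₀ n S φ jac) {h : Density P j G}
    (hχm : Measurable χ) (hhm : Measurable h) (hχ0 : ∀ U, 0 ≤ χ U) {C : ℝ} (hC : ∀ U, χ U * Real.exp (h U) ≤ C)
    {u : GaugeField P j G} (hbl : ∀ y : s → G, χ (updateFinset u s y) = χ (updateFinset u₀ s y)) {K : ℝ}
    (hK : ∀ y : s → G, |h (updateFinset u₀ s y) - h (updateFinset u s y)| ≤ K) {dev : GaugeField P j G → ℝ}
    (hdev : 0 ≤ dev u) {lam : ℝ} (hlam : 0 < lam) {S' : ℝ} (hSS' : S < S') {f₀ f₁ : (Fin n → ℝ) → ℝ}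
    (hf₀ : ContDiff ℝ 2 f₀) (hf₁ : ContDiff ℝ 2 f₁)
    (hB₀ : HessianBoundOn f₀ (cube n S') lam) (hB₁ : HessianBoundOn f₁ (cube n S') lam)
    (agree₀ : ∀ x ∈ cube n S, f₀ x = jac x - h (updateFinset u₀ s (φ x)))
    (agree₁ : ∀ x ∈ cube n S, f₁ x = jac x - h (updateFinset u s (φ x))) {bH : ℝ}
    (hgap : ∀ x ∈ cube n S,
      coordGradient (fun x => f₁ x - f₀ x) x ⬝ᵥ coordGradient (fun x => f₁ x - f₀ x) x ≤ (bH * dev u) ^ 2)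
    {B : (s → G) → β → ℝ} {T : Finset β} (hBm : ∀ b ∈ T, Measurable fun y => B y b) {L : ℝ}
    (hBg : ∀ b ∈ T, ∃ g : (Fin n → ℝ) → ℝ, ContDiff ℝ 1 g ∧ (∀ x ∈ cube n S, g x = B (φ x) b) ∧
      ∀ x ∈ cube n S, coordGradient g x ⬝ᵥ coordGradient g x ≤ L ^ 2) :
    u ∈ respDom s χ h u₀ B T dev (bH / Real.sqrt lam) (L / Real.sqrt lam) := by
  have hS : 0 ≤ S := hc.S_pos.le
  obtain ⟨g₀, hg₀, hg₀B, hg₀f, hg₀d⟩ := exists_hessianBound_extension' hS hSS' hf₀ hB₀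
  obtain ⟨g₁, hg₁, hg₁B, hg₁f, hg₁d⟩ := exists_hessianBound_extension' hS hSS' hf₁ hB₁
  refine mem_respDom_of_cubeChart hc hχm hhm hχ0 hC hbl hK hdev hlam hg₀ hg₁ hg₀B hg₁B
    (fun x hx => (hg₀f x hx).trans (agree₀ x hx)) (fun x hx => (hg₁f x hx).trans (agree₁ x hx))
    (fun x hx => ?_) hBm hBg
  have hgrad : coordGradient (fun x => g₁ x - g₀ x) x = coordGradient (fun x => f₁ x - f₀ x) x := by
    funext i
    simp only [coordGradient]
    rw [fderiv_fun_sub ((hg₁.differentiable (by norm_num)) x) ((hg₀.differentiable (by norm_num)) x),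
      fderiv_fun_sub ((hf₁.differentiable (by norm_num)) x) ((hf₀.differentiable (by norm_num)) x),
      hg₀d x hx, hg₁d x hx]
  rw [hgrad]
  exact hgap x hx

end Plug

/-! ## §5  The `SU(2)` gnomonic plug with LOCAL action convexity and the window Jacobian floor `gnoKappa` -/

section Gnomonic

variable {P : Params} {j : ℕ} {s : Finset (PBond P j)}

open T4CovarianceResponse (respDom)

/-- The window Hessian floor of the gnomonic log-Jacobian: `κ(S) = 4(1−3S²)/(1+3S²)²`
(`T4CubeChartGnomonic.window_mul_le_fderiv_fderiv_gnoJac`). [folklore] -/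
def gnoKappa (S : ℝ) : ℝ := 4 * (1 - 3 * S ^ 2) / (1 + 3 * S ^ 2) ^ 2

/-- Unfolding. [folklore] -/
theorem gnoKappa_eq (S : ℝ) : gnoKappa S = 4 * (1 - 3 * S ^ 2) / (1 + 3 * S ^ 2) ^ 2 := rfl

/-- At the centre: `κ(0) = 4`. [folklore] -/
theorem gnoKappa_zero : gnoKappa 0 = 4 := by norm_num [gnoKappa]

/-- `κ(S) ≥ 0` on `3S² ≤ 1`. [folklore] -/
theorem gnoKappa_nonneg {S : ℝ} (h : 3 * S ^ 2 ≤ 1) : 0 ≤ gnoKappa S := by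
  unfold gnoKappa
  exact div_nonneg (by linarith) (by positivity)

/-- `κ(S) ≥ −½` on `S ≤ 1` — the local floor is never worse than the GLOBAL floor `−½` of
`T4CubeChartGnomonic.hessianBound_gnoJac`. [folklore] -/
theorem neg_half_le_gnoKappa {S : ℝ} (hS1 : S ≤ 1) (hS0 : 0 ≤ S) : -(1 / 2) ≤ gnoKappa S := by
  have hA1 : 1 ≤ 1 + 3 * S ^ 2 := by nlinarith
  have hA4 : 1 + 3 * S ^ 2 ≤ 4 := by nlinarith [mul_nonneg hS0 (sub_nonneg.2 hS1)]
  have hr := ratio_anti hA1 hA4 le_rfl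
  have h1 : gnoKappa S = 4 * ((2 - (1 + 3 * S ^ 2)) / (1 + 3 * S ^ 2) ^ 2) := by
    unfold gnoKappa; ring
  rw [h1]
  norm_num at hr ⊢
  linarith

/-- **The log-Jacobian's LOCAL Hessian bound**: `Hess jac_e ≥ κ(S)` on `[-S,S]ⁿ`, `S ≤ 1`. [folklore] -/
theorem hessianBoundOn_gnoJac (e : ↥s × Fin 3 ≃ Fin n) {S : ℝ} (hS1 : S ≤ 1) :
    HessianBoundOn (gnoJac s e) (cube n S) (gnoKappa S) :=
  (hessianBoundOn_iff_fderiv (contDiff_gnoJac e)).2 fun _ hx w => window_mul_le_fderiv_fderiv_gnoJac e hS1 hx w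

/-- `Hess (jac_e + g) ≥ κ(S) + μ` on `[-S,S]ⁿ` for `C²` `g` with `Hess g ≥ μ` there. [folklore] -/
theorem hessianBoundOn_gnoJac_add (e : ↥s × Fin 3 ≃ Fin n) {S : ℝ} (hS1 : S ≤ 1) {g : (Fin n → ℝ) → ℝ}
    (hg : ContDiff ℝ 2 g) {mu : ℝ} (hB : HessianBoundOn g (cube n S) mu) :
    HessianBoundOn (fun x => gnoJac s e x + g x) (cube n S) (gnoKappa S + mu) :=
  hessianBoundOn_add (contDiff_gnoJac e) hg (hessianBoundOn_gnoJac e hS1) hB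

variable [DecidableEq (PBond P j)] {u₀ : GaugeField P j SU2} {S : ℝ}

/-- **THE `SU(2)` PLUG WITH LOCAL ACTION CONVEXITY.**  `T4CubeChartGnomonic.mem_respDom_of_gnoChart` with the GLOBAL
hypotheses `HessianBound gᵢ μ`, `μ > ½` replaced by `HessianBoundOn gᵢ [-S',S']ⁿ μ` on a neighbourhood cube
(`0 < S < S' ≤ 1`) and `κ(S') + μ > 0`; the modulus is `λ = κ(S') + μ` (`≥ μ − ½`; `→ μ + 4` as `S' ↓ 0`):
`u ∈ respDom s (windowDensity s u₀ S) h u₀ B T dev (b_H/√λ) (L/√λ)`. [folklore] -/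
theorem mem_respDom_of_gnoChart_local {β : Type*} (e : ↥s × Fin 3 ≃ Fin n) (hS : 0 < S) {S' : ℝ} (hSS' : S < S')
    (hS'1 : S' ≤ 1) {h : Density P j SU2} (hhm : Measurable h) {C : ℝ}
    (hC : ∀ U, windowDensity s u₀ S U * Real.exp (h U) ≤ C) {u : GaugeField P j SU2} {K : ℝ}
    (hK : ∀ y : ↥s → SU2, |h (updateFinset u₀ s y) - h (updateFinset u s y)| ≤ K)
    {dev : GaugeField P j SU2 → ℝ} (hdev : 0 ≤ dev u) {mu : ℝ} (hlam : 0 < gnoKappa S' + mu)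
    {g₀ g₁ : (Fin n → ℝ) → ℝ} (hg₀ : ContDiff ℝ 2 g₀) (hg₁ : ContDiff ℝ 2 g₁)
    (hB₀ : HessianBoundOn g₀ (cube n S') mu) (hB₁ : HessianBoundOn g₁ (cube n S') mu)
    (agree₀ : ∀ x ∈ cube n S, g₀ x = -h (updateFinset u₀ s (gnoFibreChart s u₀ e x)))
    (agree₁ : ∀ x ∈ cube n S, g₁ x = -h (updateFinset u s (gnoFibreChart s u₀ e x))) {bH : ℝ}
    (hgap : ∀ x ∈ cube n S,
      coordGradient (fun x => g₁ x - g₀ x) x ⬝ᵥ coordGradient (fun x => g₁ x - g₀ x) x ≤ (bH * dev u) ^ 2)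
    {B : (↥s → SU2) → β → ℝ} {T : Finset β} (hBm : ∀ b ∈ T, Measurable fun y => B y b) {L : ℝ}
    (hBg : ∀ b ∈ T, ∃ g : (Fin n → ℝ) → ℝ, ContDiff ℝ 1 g ∧
      (∀ x ∈ cube n S, g x = B (gnoFibreChart s u₀ e x) b) ∧
      ∀ x ∈ cube n S, coordGradient g x ⬝ᵥ coordGradient g x ≤ L ^ 2) :
    u ∈ respDom s (windowDensity s u₀ S) h u₀ B T dev (bH / Real.sqrt (gnoKappa S' + mu))
      (L / Real.sqrt (gnoKappa S' + mu)) := by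
  have hfg : (fun x => gnoJac s e x + g₁ x - (gnoJac s e x + g₀ x)) = fun x => g₁ x - g₀ x :=
    funext fun x => by ring
  refine mem_respDom_of_cubeChart_local (f₀ := fun x => gnoJac s e x + g₀ x) (f₁ := fun x => gnoJac s e x + g₁ x)
    (cubeChart_specialUnitaryTwo s u₀ e hS) (measurable_windowDensity s u₀ S) hhm windowDensity_nonneg hC
    (windowDensity_blind u) hK hdev hlam hSS' (contDiff_gnoJac_add e hg₀) (contDiff_gnoJac_add e hg₁)
    (hessianBoundOn_gnoJac_add e hS'1 hg₀ hB₀) (hessianBoundOn_gnoJac_add e hS'1 hg₁ hB₁) (fun x hx => ?_)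
    (fun x hx => ?_) (fun x hx => ?_) hBm hBg
  · show gnoJac s e x + g₀ x = _
    rw [agree₀ x hx]; ring
  · show gnoJac s e x + g₁ x = _
    rw [agree₁ x hx]; ring
  · show coordGradient (fun y => gnoJac s e y + g₁ y - (gnoJac s e y + g₀ y)) x ⬝ᵥ
        coordGradient (fun y => gnoJac s e y + g₁ y - (gnoJac s e y + g₀ y)) x ≤ (bH * dev u) ^ 2
    rw [hfg]
    exact hgap x hx

/-- NON-VACUITY of the modulus condition at small windows: `κ(0) + μ > 0` already for `μ = −3`
(versus `μ > ½` in the global plug). [folklore] -/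
example : (0 : ℝ) < gnoKappa 0 + (-3) := by rw [gnoKappa_zero]; norm_num

end Gnomonic

end Literature.MathematicalPhysics.QuantumFieldTheory.Balaban1983to89.T4CubeConvexExtension

end
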